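import Mathlib
import HarnessLib
import Summits.HubbardSuperconductivity.HubbardSuperconductivity.Theorems.WeakCouplingBCSKlCertTPrimeConvexAnalytic
import Summits.HubbardSuperconductivity.HubbardSuperconductivity.Theorems.WeakCouplingBCSKlCertTPrimeConvexHSChart
import Summits.HubbardSuperconductivity.HubbardSuperconductivity.Theorems.WeakCouplingBCSKlCertTPrimePHReflection

/-!
# Route `WeakCouplingBCS` — certificate half of stmt-HubbardSuperconductivity-0158, item «CONVEX-WINDOW-ANALYTIC»:
# CHANNEL STATES CLASS-WIDE on the `t`–`t′` band, hence the analytic row `KLTPAnalytic` is a THEOREM on BOTH convex arms, hypothesis-free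

Cell `gate-hubbard-kl`, seat p4 (g25); zero kit; no definitions.  Closes the booked residual «GAMMA-CHANNEL-STATES» (pen (R498)(B)) and removes the
window inequality `hH : (1 − t′μ)(1 + 4t′²) ≤ (1 − 4t′²)(1 − 2t′)` and the sign condition `μ < 0` from ✓ `kltp_analytic_Mside` (p4 g24, S4), whose only
use was margin-1's explicit hole-pocket arc `(k₀, arccos g(k₀))` (✓ `kltp_pocket_channelStates_nonempty`).  Here the arc is a piece of the POLAR CHART:

* §1–§3 (Γ-window `|t′| < 1/2`, `−4 − 4t′ < μ < 4t′`, no further hypothesis): the chart arc `A = kltpPolar t′ μ '' [π/12, π/6]` lies on the Fermi curve,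
  has `μH[1](A) ≥ u(π/6)·sin(π/12) > 0` (its image under the `1`-Lipschitz ROTATED coordinate `k ↦ cos(π/12)·k₁ − sin(π/12)·k₀` is
  `θ ↦ u(θ) sin(θ − π/12)`, which covers `[0, u(π/6) sin(π/12)]` by the intermediate value theorem — margin-1's `kltp_pocket_arc_length` pattern),
  carries density `‖∇ε‖⁻¹ ≥ 1/6` (✓ `kltp_pocket_speed_le`, ✓ `norm_gradient_kltpPolar_pos`), so `σ(A) > 0` (`kltp_chartArc_measure_pos`); at its points
  `0 < k₁ < k₀ < π`, so the five harmonics `1, cos k₀ − cos k₁, sin k₀ sin k₁, sin k₀ sin k₁ (cos k₀ − cos k₁), sin k₀` do not vanish ⇒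
  **`kltp_channelStates_nonempty_Gamma`**: every `D₄` channel has a channel state (finiteness ✓ `kltp_isFiniteMeasure_polar`);
* §4 (M-window `|t′| < 1/2`, `4t′ < μ < 4 − 4t′`, the WHOLE hole-pocket window): **`kltp_channelStates_nonempty_Mwindow`** by ✓ `klph_isChannelState_transport`
  from the Γ-side theorem at `(−t′, −μ)` — no arc, no `hH`, no `μ < 0`;
* §5 consequences: **`kltp_analytic_of_convex (hN)`** (Γ side: `KLTPAnalytic` from strict convexity along the chart ALONE), **`kltp_analytic_farGamma`**
  (`−1/2 < t′ < 0`, `−4 − 4t′ < μ < μ_c(t′)`; HYPOTHESIS-FREE, ⇐ ✓ `kltp_HS_farGamma`), **`kltp_analytic_Mside'`** (`−1/2 < t′ < 0`,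
  `4t′ < μ < min(4 − 4t′, 4t′ + 32|t′|(1 − 4t′²))` — the whole M-side convexity band, ⇐ ✓ `kltp_HS_Mside`), and the record closers
  **`kltp_window_U_of_E'` / `kltpj_window_U_of_E'`** (M side, three window inequalities per box) and **`kltp_window_U_of_E_farGamma` /
  `kltpj_window_U_of_E_farGamma`** (far-Γ side, two): ANY kernel-checked `t′ < 0` certificate on either convex arm, single or joint, lands MODULO ITS
  CERTIFIED ENCLOSURES by one lemma + `norm_num` window checks.

HONEST LABEL: analytic-side leaves only; no record is created or decided here (KIT FREEZE); records stay RECORD-class, conditional on their certified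
enclosures; RECORD ≠ DECIDED; nothing about `K₃`, `U₀`, the doping window or superconductivity; a Kohn–Luttinger `O(U²)` channel statement is not ODLRO;
nothing here proves superconductivity in the Hubbard model.
References: S. Raghu, S. A. Kivelson, D. J. Scalapino, Phys. Rev. B 81 (2010) 224505, §II (5)–(8), §III (17) and Fig. 3; L. C. Evans, R. F. Gariepy,
*Measure Theory and Fine Properties of Functions* (1992), §2.4 (Lipschitz images under Hausdorff measure).
-/

noncomputable section

-- the tree's namespace `Summit.<Summit>.<Problem>.Theorems` repeats the summit name by design (D-0017)
set_option linter.dupNamespace false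

namespace Summit.HubbardSuperconductivity.HubbardSuperconductivity.Theorems

open MeasureTheory Set Real Literature.MathematicalPhysics.QuantumLattice KlTPrimeConvexity KlCertTPrimeJoint CwKLChiralWindow
open scoped ENNReal NNReal

/-! ### §1 A rotated `1`-Lipschitz coordinate -/

/-- The rotated second coordinate `k ↦ cos α · k₁ − sin α · k₀` is `1`-Lipschitz on momentum space. [cite: EvansGariepy1992, §2.4 Thm 1] -/
theorem kltp_lipschitz_rotProj (α : ℝ) :
    LipschitzWith 1 (fun k : Momentum => Real.cos α * k 1 - Real.sin α * k 0) := by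
  refine LipschitzWith.mk_one fun k k' => ?_
  rw [EuclideanSpace.dist_eq, Real.dist_eq]
  have hcs := Real.cos_sq_add_sin_sq α
  have key : (Real.cos α * (k 1 - k' 1) - Real.sin α * (k 0 - k' 0)) ^ 2 +
      (Real.cos α * (k 0 - k' 0) + Real.sin α * (k 1 - k' 1)) ^ 2 = (k 0 - k' 0) ^ 2 + (k 1 - k' 1) ^ 2 := by
    linear_combination ((k 0 - k' 0) ^ 2 + (k 1 - k' 1) ^ 2) * hcs
  have h : |Real.cos α * k 1 - Real.sin α * k 0 - (Real.cos α * k' 1 - Real.sin α * k' 0)| ^ 2 ≤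
      ∑ i, dist (k i) (k' i) ^ 2 := by
    rw [Fin.sum_univ_two, Real.dist_eq, Real.dist_eq, sq_abs, sq_abs, sq_abs]
    have he : Real.cos α * k 1 - Real.sin α * k 0 - (Real.cos α * k' 1 - Real.sin α * k' 0) =
        Real.cos α * (k 1 - k' 1) - Real.sin α * (k 0 - k' 0) := by ring
    rw [he]
    nlinarith [sq_nonneg (Real.cos α * (k 0 - k' 0) + Real.sin α * (k 1 - k' 1)), key]
  calc |Real.cos α * k 1 - Real.sin α * k 0 - (Real.cos α * k' 1 - Real.sin α * k' 0)|
      = Real.sqrt (|Real.cos α * k 1 - Real.sin α * k 0 - (Real.cos α * k' 1 - Real.sin α * k' 0)| ^ 2) := by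
        rw [Real.sqrt_sq (abs_nonneg _)]
    _ ≤ Real.sqrt (∑ i, dist (k i) (k' i) ^ 2) := Real.sqrt_le_sqrt h

/-! ### §2 The chart arc `kltpPolar '' [π/12, π/6]` on the Γ-window: trigonometry, length, positive measure -/

section Window

variable {tp μ : ℝ} (htp : |tp| < 1 / 2) (hμ₁ : -4 - 4 * tp < μ) (hμ₂ : μ < 4 * tp)
include htp hμ₁ hμ₂

/-- At a chart point of angle `θ ∈ [π/12, π/6]` one has `0 < k₁ < k₀ < π`, hence `0 < sin k₀`, `0 < sin k₁`, `cos k₀ − cos k₁ < 0`. [folklore] -/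
theorem kltp_chartArc_trig {θ : ℝ} (hθ : θ ∈ Icc (π / 12) (π / 6)) :
    0 < Real.sin (kltpPolar tp μ θ 0) ∧ 0 < Real.sin (kltpPolar tp μ θ 1) ∧
      Real.cos (kltpPolar tp μ θ 0) - Real.cos (kltpPolar tp μ θ 1) < 0 := by
  have hπ := Real.pi_pos
  have hr := kltpRadius_pos htp hμ₁ hμ₂ θ
  have h0 := (abs_lt.1 (abs_kltpRadius_mul_dir_lt htp hμ₁ hμ₂ θ 0)).2
  have h1 := (abs_lt.1 (abs_kltpRadius_mul_dir_lt htp hμ₁ hμ₂ θ 1)).2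
  rw [dir_zero] at h0
  rw [dir_one] at h1
  rw [kltpPolar_apply_zero, kltpPolar_apply_one]
  have hθ1 : 0 < θ := by linarith [hθ.1]
  have hsθ : 0 < Real.sin θ := sin_pos_of_pos_of_lt_pi hθ1 (by linarith [hθ.2])
  have hcθ : 0 < Real.cos θ := cos_pos_of_mem_Ioo ⟨by linarith, by linarith [hθ.2]⟩
  have hsc : Real.sin θ < Real.cos θ := by
    rw [← Real.sin_pi_div_two_sub]
    exact Real.strictMonoOn_sin ⟨by linarith, by linarith [hθ.2]⟩ ⟨by linarith [hθ.2], by linarith⟩ (by linarith [hθ.2])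
  have hk0 : 0 < kltpRadius tp μ θ * Real.cos θ := mul_pos hr hcθ
  have hk1 : 0 < kltpRadius tp μ θ * Real.sin θ := mul_pos hr hsθ
  have hlt : kltpRadius tp μ θ * Real.sin θ < kltpRadius tp μ θ * Real.cos θ := mul_lt_mul_of_pos_left hsc hr
  refine ⟨sin_pos_of_pos_of_lt_pi hk0 h0, sin_pos_of_pos_of_lt_pi hk1 h1, ?_⟩
  have := Real.cos_lt_cos_of_nonneg_of_le_pi hk1.le h0.le hlt
  linarith

/-- **Length of the chart arc**: `μH[1](kltpPolar '' [π/12, π/6]) ≥ u(π/6)·sin(π/12)` — the rotated coordinate `cos(π/12)·k₁ − sin(π/12)·k₀`, a `1`-Lipschitz map,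
takes the value `u(θ) sin(θ − π/12)` at the chart point of angle `θ`, so by the intermediate value theorem its image of the arc covers `[0, u(π/6) sin(π/12)]`.
[cite: EvansGariepy1992, §2.4 Thm 1] -/
theorem kltp_chartArc_length :
    ENNReal.ofReal (kltpRadius tp μ (π / 6) * Real.sin (π / 12)) ≤ μH[1] (kltpPolar tp μ '' Icc (π / 12) (π / 6)) := by
  have hπ := Real.pi_pos
  set A := kltpPolar tp μ '' Icc (π / 12) (π / 6) with hA
  set P : Momentum → ℝ := fun k => Real.cos (π / 12) * k 1 - Real.sin (π / 12) * k 0 with hP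
  have hcomp : ∀ θ, P (kltpPolar tp μ θ) = kltpRadius tp μ θ * Real.sin (θ - π / 12) := by
    intro θ
    simp only [hP, kltpPolar_apply_zero, kltpPolar_apply_one, Real.sin_sub]
    ring
  have hcont : Continuous fun θ => P (kltpPolar tp μ θ) := by
    have : (fun θ => P (kltpPolar tp μ θ)) = fun θ => kltpRadius tp μ θ * Real.sin (θ - π / 12) := funext hcomp
    rw [this]
    exact (continuous_kltpRadius htp hμ₁ hμ₂).mul (by fun_prop)
  have hcover : Icc 0 (kltpRadius tp μ (π / 6) * Real.sin (π / 12)) ⊆ P '' A := by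
    have hivt := intermediate_value_Icc (show π / 12 ≤ π / 6 by linarith) hcont.continuousOn
    rw [hcomp, hcomp, sub_self, Real.sin_zero, mul_zero, show π / 6 - π / 12 = π / 12 by ring] at hivt
    intro x hx
    obtain ⟨θ, hθ, hθx⟩ := hivt hx
    exact ⟨kltpPolar tp μ θ, ⟨θ, hθ, rfl⟩, hθx⟩
  have h1 : μH[1] (Icc (0 : ℝ) (kltpRadius tp μ (π / 6) * Real.sin (π / 12))) =
      ENNReal.ofReal (kltpRadius tp μ (π / 6) * Real.sin (π / 12)) := by
    rw [hausdorffMeasure_real, Real.volume_Icc, sub_zero]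
  have h2 : μH[1] (P '' A) ≤ μH[1] A := by
    have h := (kltp_lipschitz_rotProj (π / 12)).hausdorffMeasure_image_le (d := 1) zero_le_one A
    simpa using h
  calc ENNReal.ofReal (kltpRadius tp μ (π / 6) * Real.sin (π / 12))
      = μH[1] (Icc (0 : ℝ) (kltpRadius tp μ (π / 6) * Real.sin (π / 12))) := h1.symm
    _ ≤ μH[1] (P '' A) := measure_mono hcover
    _ ≤ μH[1] A := h2

/-- The arc length bound is positive: `0 < u(π/6)·sin(π/12)`. [folklore] -/
theorem kltp_chartArc_length_pos : 0 < kltpRadius tp μ (π / 6) * Real.sin (π / 12) :=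
  mul_pos (kltpRadius_pos htp hμ₁ hμ₂ _) (sin_pos_of_pos_of_lt_pi (by positivity) (by linarith [Real.pi_pos]))

/-- **The chart arc has positive Fermi-curve measure**: `σ[ε_{t′}, μ](kltpPolar '' [π/12, π/6]) ≥ (1/6)·u(π/6)·sin(π/12) > 0` (density `‖∇ε‖⁻¹ ≥ 1/6` on the
chart by `‖∇ε_{t′}‖ ≤ 6` and `∇ε_{t′} ≠ 0` there). [cite: RaghuKivelsonScalapino2010, §II (6)] -/
theorem kltp_chartArc_measure_pos :
    0 < fermiCurveMeasure (squareDispersion 1 tp) μ (kltpPolar tp μ '' Icc (π / 12) (π / 6)) := by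
  have htp' := abs_lt.1 htp
  set ε := squareDispersion 1 tp with hε
  set A := kltpPolar tp μ '' Icc (π / 12) (π / 6) with hA
  have hAm : MeasurableSet A := (isCompact_Icc.image (continuous_kltpPolar htp hμ₁ hμ₂)).isClosed.measurableSet
  have hAF : A ⊆ fermiCurve ε μ := by
    rintro _ ⟨θ, -, rfl⟩
    exact kltpPolar_mem_fermiCurve htp hμ₁ hμ₂ θ
  have hdens : ∀ k ∈ A, ENNReal.ofReal (1 / 6) ≤ ENNReal.ofReal (‖gradient ε k‖⁻¹) := by
    rintro _ ⟨θ, -, rfl⟩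
    apply ENNReal.ofReal_le_ofReal
    rw [one_div]
    exact inv_anti₀ (norm_gradient_kltpPolar_pos htp hμ₁ hμ₂ θ) (kltp_pocket_speed_le (by linarith) (by linarith) _)
  unfold fermiCurveMeasure
  rw [withDensity_apply _ hAm, Measure.restrict_restrict hAm, inter_eq_left.2 hAF]
  have hlow : ENNReal.ofReal (1 / 6) * μH[1] A ≤
      ∫⁻ k in A, ENNReal.ofReal (‖gradient ε k‖⁻¹) ∂(μH[1] : Measure Momentum) := by
    calc ENNReal.ofReal (1 / 6) * μH[1] A
        = ∫⁻ _ in A, ENNReal.ofReal (1 / 6) ∂(μH[1] : Measure Momentum) := by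
          rw [lintegral_const, Measure.restrict_apply MeasurableSet.univ, univ_inter]
      _ ≤ ∫⁻ k in A, ENNReal.ofReal (‖gradient ε k‖⁻¹) ∂(μH[1] : Measure Momentum) := by
          refine lintegral_mono_ae ?_
          filter_upwards [ae_restrict_mem hAm] with k hk
          exact hdens k hk
  refine lt_of_lt_of_le ?_ hlow
  have hlen : ENNReal.ofReal (kltpRadius tp μ (π / 6) * Real.sin (π / 12)) ≤ μH[1] A := kltp_chartArc_length htp hμ₁ hμ₂
  have h6 : (0 : ℝ≥0∞) < ENNReal.ofReal (1 / 6) := ENNReal.ofReal_pos.2 (by norm_num)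
  have hℓ : (0 : ℝ≥0∞) < ENNReal.ofReal (kltpRadius tp μ (π / 6) * Real.sin (π / 12)) :=
    ENNReal.ofReal_pos.2 (kltp_chartArc_length_pos htp hμ₁ hμ₂)
  exact lt_of_lt_of_le (ENNReal.mul_pos h6.ne' hℓ.ne') (mul_le_mul' le_rfl hlen)

/-- A continuous bounded function vanishing at no chart point of angle in `[π/12, π/6]` has positive square integral against `σ[ε_{t′}, μ]` on the Γ-window.
[folklore] -/
theorem kltp_chart_sq_integral_pos {φ : Momentum → ℝ} (hφ : Continuous φ) {C : ℝ} (hC : ∀ k, |φ k| ≤ C)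
    (hne : ∀ θ ∈ Icc (π / 12) (π / 6), φ (kltpPolar tp μ θ) ≠ 0) :
    0 < ∫ k, φ k ^ 2 ∂fermiCurveMeasure (squareDispersion 1 tp) μ := by
  set σ := fermiCurveMeasure (squareDispersion 1 tp) μ with hσ
  haveI : IsFiniteMeasure σ := kltp_isFiniteMeasure_polar htp hμ₁ hμ₂
  have hmeas : AEStronglyMeasurable (fun k => φ k ^ 2) σ := (hφ.pow 2).aestronglyMeasurable
  have hint : Integrable (fun k => φ k ^ 2) σ := by
    refine (MemLp.of_bound hmeas (C ^ 2) (Filter.Eventually.of_forall fun k => ?_)).integrable le_rfl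
    rw [Real.norm_eq_abs, abs_pow, ← sq_abs C]
    exact pow_le_pow_left₀ (abs_nonneg _) ((hC k).trans (le_abs_self C)) 2
  rw [integral_pos_iff_support_of_nonneg (fun k => sq_nonneg (φ k)) hint]
  refine lt_of_lt_of_le (kltp_chartArc_measure_pos htp hμ₁ hμ₂) (measure_mono ?_)
  rintro _ ⟨θ, hθ, rfl⟩
  rw [Function.mem_support]
  exact pow_ne_zero 2 (hne θ hθ)

/-! ### §3 Channel states in every `D₄` channel on the Γ-window -/

/-- **Every symmetry channel has a channel state at every Γ-pocket of the `t`–`t′` band** (`|t′| < 1/2`, `−4 − 4t′ < μ < 4t′`, NO further hypothesis):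
witnesses `1`, `cos k₀ − cos k₁`, `sin k₀ sin k₁`, `sin k₀ sin k₁ (cos k₀ − cos k₁)`, `sin k₀`, each of positive `L²(σ)`-norm by the chart arc.
[cite: RaghuKivelsonScalapino2010, §III (17)] -/
theorem kltp_channelStates_nonempty_Gamma (χ : D4Irrep) :
    {ψ | IsChannelState (squareDispersion 1 tp) μ χ ψ}.Nonempty := by
  haveI : IsFiniteMeasure (fermiCurveMeasure (squareDispersion 1 tp) μ) := kltp_isFiniteMeasure_polar htp hμ₁ hμ₂
  have arc : ∀ θ ∈ Icc (π / 12) (π / 6),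
      0 < Real.sin (kltpPolar tp μ θ 0) ∧ 0 < Real.sin (kltpPolar tp μ θ 1) ∧
        Real.cos (kltpPolar tp μ θ 0) - Real.cos (kltpPolar tp μ θ 1) < 0 := fun θ hθ => kltp_chartArc_trig htp hμ₁ hμ₂ hθ
  have hbdcos : ∀ k : Momentum, |Real.cos (k 0) - Real.cos (k 1)| ≤ 2 := fun k => by
    have h1 := abs_cos_le_one (k 0); have h2 := abs_cos_le_one (k 1)
    calc |Real.cos (k 0) - Real.cos (k 1)| ≤ |Real.cos (k 0)| + |Real.cos (k 1)| := abs_sub _ _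
      _ ≤ 2 := by linarith
  have hbdsin : ∀ k : Momentum, |Real.sin (k 0) * Real.sin (k 1)| ≤ 1 := fun k => by
    rw [abs_mul]
    have h1 := abs_sin_le_one (k 0); have h2 := abs_sin_le_one (k 1)
    nlinarith [abs_nonneg (Real.sin (k 0)), abs_nonneg (Real.sin (k 1))]
  cases χ with
  | A1g =>
    exact klph_channelStates_nonempty_of_bound_of_pos (φ := fun _ => (1 : ℝ)) continuous_const.aestronglyMeasurable
      (C := 1) (fun _ => by simp) (inChannel_A1g_const 1)
      (kltp_chart_sq_integral_pos htp hμ₁ hμ₂ continuous_const (C := 1) (fun _ => by simp) (fun _ _ => one_ne_zero))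
  | B1g =>
    have hcont : Continuous fun k : Momentum => Real.cos (k 0) - Real.cos (k 1) := by fun_prop
    exact klph_channelStates_nonempty_of_bound_of_pos hcont.aestronglyMeasurable hbdcos inChannel_B1g_harmonic
      (kltp_chart_sq_integral_pos htp hμ₁ hμ₂ hcont hbdcos fun θ hθ => (arc θ hθ).2.2.ne)
  | B2g =>
    have hcont : Continuous fun k : Momentum => Real.sin (k 0) * Real.sin (k 1) := by fun_prop
    exact klph_channelStates_nonempty_of_bound_of_pos hcont.aestronglyMeasurable hbdsin inChannel_B2g_harmonic
      (kltp_chart_sq_integral_pos htp hμ₁ hμ₂ hcont hbdsin fun θ hθ =>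
        (mul_pos (arc θ hθ).1 (arc θ hθ).2.1).ne')
  | A2g =>
    have hcont : Continuous fun k : Momentum => Real.sin (k 0) * Real.sin (k 1) * (Real.cos (k 0) - Real.cos (k 1)) := by fun_prop
    have hbd : ∀ k : Momentum, |Real.sin (k 0) * Real.sin (k 1) * (Real.cos (k 0) - Real.cos (k 1))| ≤ 2 := fun k => by
      rw [abs_mul]
      nlinarith [abs_nonneg (Real.sin (k 0) * Real.sin (k 1)), abs_nonneg (Real.cos (k 0) - Real.cos (k 1)), hbdsin k, hbdcos k]
    exact klph_channelStates_nonempty_of_bound_of_pos hcont.aestronglyMeasurable hbd inChannel_A2g_harmonic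
      (kltp_chart_sq_integral_pos htp hμ₁ hμ₂ hcont hbd fun θ hθ => by
        have hb := arc θ hθ
        exact (mul_neg_of_pos_of_neg (mul_pos hb.1 hb.2.1) hb.2.2).ne)
  | E =>
    have hcont : Continuous fun k : Momentum => Real.sin (k 0) := by fun_prop
    exact klph_channelStates_nonempty_of_bound_of_pos hcont.aestronglyMeasurable (fun k => abs_sin_le_one (k 0))
      inChannel_E_harmonic (kltp_chart_sq_integral_pos htp hμ₁ hμ₂ hcont (fun k => abs_sin_le_one (k 0))
        fun θ hθ => (arc θ hθ).1.ne')

/-- **`KLTPAnalytic` at a STRICTLY CONVEX Γ-pocket from convexity along the chart ALONE** (`|t′| < 1/2`, `−4 − 4t′ < μ < 4t′`, `0 < curvNum t′` on the chart):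
finiteness ✓ `kltp_isFiniteMeasure_polar`, the `D₄` rows (theorems), Hilbert–Schmidt ✓ `kltp_HS_of_convex`, channel states §3. [cite: RaghuKivelsonScalapino2010, §II (5)-(8)] -/
theorem kltp_analytic_of_convex (hN : ∀ θ : ℝ, 0 < curvNum tp (kltpX tp μ θ) (kltpY tp μ θ)) :
    KLTPAnalytic (squareDispersion 1 tp) μ :=
  klTPAnalytic_of tp μ (kltp_isFiniteMeasure_polar htp hμ₁ hμ₂) (kltp_HS_of_convex htp hμ₁ hμ₂ hN)
    (kltp_channelStates_nonempty_Gamma htp hμ₁ hμ₂)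

end Window

/-! ### §4 Channel states on the whole M-window, by the particle–hole transport -/

/-- **Every symmetry channel has a channel state at every hole pocket about `M`** (`|t′| < 1/2`, `4t′ < μ < 4 − 4t′`, the WHOLE M-window — no `μ < 0`, no
`hH`): transported by ✓ `klph_isChannelState_transport` from the Γ-pocket of the reflected band `(−t′, −μ)`. [cite: RaghuKivelsonScalapino2010, §III (17)] -/
theorem kltp_channelStates_nonempty_Mwindow {tp μ : ℝ} (htp : |tp| < 1 / 2) (hvh : 4 * tp < μ) (htop : μ < 4 - 4 * tp) (χ : D4Irrep) :
    {ψ | IsChannelState (squareDispersion 1 tp) μ χ ψ}.Nonempty := by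
  have htp' : |(-tp)| < 1 / 2 := by rwa [abs_neg]
  obtain ⟨ψ, hψ⟩ := kltp_channelStates_nonempty_Gamma htp' (μ := -μ) (by linarith) (by linarith) χ
  have h := (klph_isChannelState_transport (-tp) (-μ) χ hψ).1
  rw [neg_neg, neg_neg] at h
  exact ⟨_, h⟩

/-- **The Fermi-curve measure of every hole pocket about `M` is finite** (`|t′| < 1/2`, `4t′ < μ < 4 − 4t′`): push-forward of the Γ-side finiteness of the
reflected band under the particle–hole shift (✓ `klph_measurePreserving_shift_fermiCurveMeasure`). [cite: RaghuKivelsonScalapino2010, §II (6)] -/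
theorem kltp_isFiniteMeasure_Mwindow {tp μ : ℝ} (htp : |tp| < 1 / 2) (hvh : 4 * tp < μ) (htop : μ < 4 - 4 * tp) :
    IsFiniteMeasure (fermiCurveMeasure (squareDispersion 1 tp) μ) := by
  have htp' : |(-tp)| < 1 / 2 := by rwa [abs_neg]
  haveI : IsFiniteMeasure (fermiCurveMeasure (squareDispersion 1 (-tp)) (-μ)) :=
    kltp_isFiniteMeasure_polar htp' (by linarith) (by linarith)
  rw [← (klph_measurePreserving_shift_fermiCurveMeasure tp μ).map_eq]
  infer_instance

/-- **`KLTPAnalytic` on the M-window from the Hilbert–Schmidt row ALONE** (`|t′| < 1/2`, `4t′ < μ < 4 − 4t′`): finiteness and channel states are theorems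
(§4), the `D₄` rows too. [cite: RaghuKivelsonScalapino2010, §II (5)-(8)] -/
theorem kltp_analytic_Mwindow_of_HS {tp μ : ℝ} (htp : |tp| < 1 / 2) (hvh : 4 * tp < μ) (htop : μ < 4 - 4 * tp)
    (hHS : MemLp (fun z : Momentum × Momentum => lindhardFunction (squareDispersion 1 tp) μ (z.1 + z.2)) 2
      ((fermiCurveMeasure (squareDispersion 1 tp) μ).prod (fermiCurveMeasure (squareDispersion 1 tp) μ))) :
    KLTPAnalytic (squareDispersion 1 tp) μ :=
  klTPAnalytic_of tp μ (kltp_isFiniteMeasure_Mwindow htp hvh htop) hHS (kltp_channelStates_nonempty_Mwindow htp hvh htop)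

/-! ### §5 The analytic row on both convex arms, hypothesis-free, and the record closers -/

/-- **The analytic side is a THEOREM on the whole M-side convexity band**: for `−1/2 < t′ < 0` and `4t′ < μ < min(4 − 4t′, 4t′ + 32|t′|(1 − 4t′²))`,
`KLTPAnalytic (squareDispersion 1 t′) μ` holds — ✓ `kltp_analytic_Mside` WITHOUT its window inequality `hH` and WITHOUT `μ < 0`
(Hilbert–Schmidt ✓ `kltp_HS_Mside`). [cite: RaghuKivelsonScalapino2010, §II (5)-(8)] -/
theorem kltp_analytic_Mside' {tp μ : ℝ} (htp1 : -1 / 2 < tp) (htp0 : tp < 0) (hvh : 4 * tp < μ) (htop : μ < 4 - 4 * tp)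
    (hdisc : μ - 4 * tp < 32 * |tp| * (1 - 4 * tp ^ 2)) :
    KLTPAnalytic (squareDispersion 1 tp) μ :=
  kltp_analytic_Mwindow_of_HS (abs_lt.2 ⟨by linarith, by linarith⟩) hvh htop (kltp_HS_Mside htp1 htp0 hvh htop hdisc)

/-- **The analytic side is a THEOREM on the far-Γ arm**: for `−1/2 < t′ < 0` and `−4 − 4t′ < μ < μ_c(t′)` (`convexityReturnLevel`), `KLTPAnalytic (squareDispersion 1 t′) μ`
holds with NO hypothesis (strict convexity ✓ `farGamma_curvNum_pos`, Hilbert–Schmidt ✓ `kltp_HS_farGamma`, channel states §3) — the booked residual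
«GAMMA-CHANNEL-STATES» is discharged. [cite: RaghuKivelsonScalapino2010, §II (5)-(8)] -/
theorem kltp_analytic_farGamma {tp μ : ℝ} (htp1 : -1 / 2 < tp) (htp0 : tp < 0) (hbot : -4 - 4 * tp < μ) (hμc : μ < convexityReturnLevel tp) :
    KLTPAnalytic (squareDispersion 1 tp) μ := by
  have htp : |tp| < 1 / 2 := abs_lt.2 ⟨by linarith, by linarith⟩
  have hμ₂ : μ < 4 * tp := hμc.trans (convexityReturnLevel_lt_vanHove htp1 htp0)
  exact klTPAnalytic_of tp μ (kltp_isFiniteMeasure_polar htp hbot hμ₂) (kltp_HS_farGamma htp1 htp0 hbot hμc)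
    (kltp_channelStates_nonempty_Gamma htp hbot hμ₂)

/-- **The analytic chart** (`−1/2 < t′ < 0`): on BOTH convex arms of ✓ `convexityChart` the bundled analytic hypothesis `KLTPAnalytic (squareDispersion 1 t′) μ`
holds with no further hypothesis. [cite: RaghuKivelsonScalapino2010, §II (5)-(8)] -/
theorem kltp_analytic_convexChart {tp μ : ℝ} (htp1 : -1 / 2 < tp) (htp0 : tp < 0) :
    (-4 - 4 * tp < μ → μ < convexityReturnLevel tp → KLTPAnalytic (squareDispersion 1 tp) μ) ∧
    (4 * tp < μ → μ < 4 - 4 * tp → μ - 4 * tp < 32 * |tp| * (1 - 4 * tp ^ 2) → KLTPAnalytic (squareDispersion 1 tp) μ) :=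
  ⟨fun hbot hμc => kltp_analytic_farGamma htp1 htp0 hbot hμc, fun hvh htop hdisc => kltp_analytic_Mside' htp1 htp0 hvh htop hdisc⟩

/-- **ANY ACCEPTED M-SIDE `t′` RECORD LANDS MODULO ITS ENCLOSURES** (three window inequalities per box): a kernel-checked certificate `c`
(`c.checkB1gD = true`) whose boxes lie in the M-side convexity band gives `KLB1gDominatesTP t′ mub mua γ` from its certified enclosures `hE` ALONE.
[cite: RaghuKivelsonScalapino2010, §III Fig. 3] -/
theorem kltp_window_U_of_E' (tp : ℝ) (c : KLCert) (hc : c.checkB1gD = true) (htp1 : -1 / 2 < tp) (htp0 : tp < 0)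
    (hwin : ∀ bx ∈ c.boxes, ∀ μ ∈ Set.Icc (bx.mulo : ℝ) (bx.muhi : ℝ),
      4 * tp < μ ∧ μ < 4 - 4 * tp ∧ μ - 4 * tp < 32 * |tp| * (1 - 4 * tp ^ 2))
    (hE : c.EnclosuresB1gTP tp) :
    KLB1gDominatesTP tp ((c.mub : ℚ) : ℝ) ((c.mua : ℚ) : ℝ) ((c.gamma : ℚ) : ℝ) :=
  kltp_window_U tp c hc (fun bx hbx μ hμ =>
    kltp_analytic_Mside' htp1 htp0 (hwin bx hbx μ hμ).1 (hwin bx hbx μ hμ).2.1 (hwin bx hbx μ hμ).2.2) hE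

/-- **The same for JOINT certificates on the M side.** [cite: RaghuKivelsonScalapino2010, §III Fig. 3] -/
theorem kltpj_window_U_of_E' (tp : ℝ) (c : KLCert) (rows : List KLJRow) (γ : ℚ) (hc : checkB1gJ c rows γ = true) (htp1 : -1 / 2 < tp)
    (htp0 : tp < 0)
    (hwin : ∀ bx ∈ c.boxes, ∀ μ ∈ Set.Icc (bx.mulo : ℝ) (bx.muhi : ℝ),
      4 * tp < μ ∧ μ < 4 - 4 * tp ∧ μ - 4 * tp < 32 * |tp| * (1 - 4 * tp ^ 2))
    (hE : JointEnclosuresB1gTP c rows tp) :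
    KLB1gDominatesTP tp ((c.mub : ℚ) : ℝ) ((c.mua : ℚ) : ℝ) ((γ : ℚ) : ℝ) :=
  kltpj_window_U tp c rows γ hc (fun bx hbx μ hμ =>
    kltp_analytic_Mside' htp1 htp0 (hwin bx hbx μ hμ).1 (hwin bx hbx μ hμ).2.1 (hwin bx hbx μ hμ).2.2) hE

/-- **ANY ACCEPTED FAR-Γ `t′` RECORD LANDS MODULO ITS ENCLOSURES** (two window inequalities per box: `−4 − 4t′ < μ < μ_c(t′)`).
[cite: RaghuKivelsonScalapino2010, §III Fig. 3] -/
theorem kltp_window_U_of_E_farGamma (tp : ℝ) (c : KLCert) (hc : c.checkB1gD = true) (htp1 : -1 / 2 < tp) (htp0 : tp < 0)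
    (hwin : ∀ bx ∈ c.boxes, ∀ μ ∈ Set.Icc (bx.mulo : ℝ) (bx.muhi : ℝ), -4 - 4 * tp < μ ∧ μ < convexityReturnLevel tp)
    (hE : c.EnclosuresB1gTP tp) :
    KLB1gDominatesTP tp ((c.mub : ℚ) : ℝ) ((c.mua : ℚ) : ℝ) ((c.gamma : ℚ) : ℝ) :=
  kltp_window_U tp c hc (fun bx hbx μ hμ => kltp_analytic_farGamma htp1 htp0 (hwin bx hbx μ hμ).1 (hwin bx hbx μ hμ).2) hE

/-- **The same for JOINT certificates on the far-Γ side.** [cite: RaghuKivelsonScalapino2010, §III Fig. 3] -/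
theorem kltpj_window_U_of_E_farGamma (tp : ℝ) (c : KLCert) (rows : List KLJRow) (γ : ℚ) (hc : checkB1gJ c rows γ = true)
    (htp1 : -1 / 2 < tp) (htp0 : tp < 0)
    (hwin : ∀ bx ∈ c.boxes, ∀ μ ∈ Set.Icc (bx.mulo : ℝ) (bx.muhi : ℝ), -4 - 4 * tp < μ ∧ μ < convexityReturnLevel tp)
    (hE : JointEnclosuresB1gTP c rows tp) :
    KLB1gDominatesTP tp ((c.mub : ℚ) : ℝ) ((c.mua : ℚ) : ℝ) ((γ : ℚ) : ℝ) :=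
  kltpj_window_U tp c rows γ hc (fun bx hbx μ hμ => kltp_analytic_farGamma htp1 htp0 (hwin bx hbx μ hμ).1 (hwin bx hbx μ hμ).2) hE

end Summit.HubbardSuperconductivity.HubbardSuperconductivity.Theorems

end
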